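import Summits.QuantumFields.YangMills.Theorems.UV3PinnedRestrictedPin
import Summits.QuantumFields.YangMills.Theorems.AlphaInputsT3ACBridge
import HarnessLib

/-!
# R3 (cell `ym3-torus`, YM₃ on T³ — a ladder RUNG, NOT d = 4, NOT the Clay problem), UV3-node side of `stub_pinnedStep` (R-19936-S) —
# **ROW (S-i) IN T³ LETTERS: THE PINNED (41) FOR THE ROUTE'S RESTRICTED DENSITY `resDensity`, `dV`-a.e., MODULO THE (α) PACKAGE**

Seat `ym3-torus-px8` g11.  THEOREMS ONLY (0 `def`, 0 `sorry`); `--supports stmt-QuantumFields-19936 --as helper`; count-neutral.  LOCATE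
`LOCATE-PINNED41-RESTRICTION-px8g11.md` (19936 evidence #57) §3 row (S-i), cell-level read of ✓`UV3PinnedRestrictedStep.pinned41_above_of_residualsAC`
(px8 g11 BRICK B2, file `UV3PinnedRestrictedPin`): under the package's data at `(γ, K)` (`AlphaInputsT3ACBridge.AlphaInputsT3AC.PkgAt`, the record the socket `AlphaInputsT3AC.Of F 𝔠`
inhabits by `Of.pkgAt`), for a pinned level `s` (`s + 1 ≤ K`), a plaquette `a` of level `s` and a threshold `θ` at least the lane's large-field
threshold `eps1Of s` (the PACKAGE profile — LOCATE (F2); w8 g11 ✓p748050 `UV3PinnedStepProfileReduction` feeds every steeper event profile from it):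
the route's restricted density of the PURE PIN «`θ ≤ dist1 (Ū^s U)(∂a)`» is, at every level `s + 1 ≤ k ≤ K` and `dV_k`-a.e., below `e^{E}` times the
lane's (41)_k history sum RESTRICTED to the histories through the pin (`a ∈ P_s(h)`) or already large near `a` below `s` (`¬ plaqCover a ⊆ Ω_s(h↾s)`);
at the unit lattice `k = K`, in the interface's normal form (`Ecst := E_K − E`, constants pulled out) against the PENALISED functional
`LF_K(W)[−mainT + Pint + Zterm − π]` for ANY penalty `π` vanishing on that family — the input currency of ✓p742243
`UV3PinnedLargeFieldResummation.largeField_pinned_of_resummation` (row (S-ii), the XL organ, NOT here).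

Ingredients: B2 §5 at the lane's objects `towerOfAC 𝔠.lane p.X p.𝔖`; the cell's tower IS the lane's RN iteration (`AlphaInputsT3AC.avT3_of_le`,
lit `T3RestrictedUnitDensity.towerDensity_succ`; §1 `towerDensity_succ_eq_rnTransport`); the `e^{E}` normalisation (`PkgAt.resDensity_ae_eq`,
`rnTransport_const_mul_ae`, Bridge §1); the pin read at level `s` as an indicator on the level-`s` field (§1 `resDensity_preimage_ae_eq_indicator_mul`:
`ρ^{(Ū^s)⁻¹A}_s = 𝟙_A·ρ_s` a.e., the push-forward identity (2)∕(6) — lit `integral_resDensity_mul` — on both sides, ★★OWNER RULING №32 letters);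
the residual leaves ∕ `hint` ∕ `fibre49` from `p.run : RunAlphaAC` (`Thm2AC.stepResidualsAC_of_alpha`, `Bound55AC.hint_stdAC`, `StepAlphaAC.fibre49`).

WHAT IS PROVED (ns `…Theorems.UV3PinnedStepOfPackage`):
* §1 `towerDensity_succ_eq_rnTransport`, ★ `resDensity_preimage_ae_eq_indicator_mul`.
* §2 ★★★ `AlphaInputsT3AC.PkgAt.resDensity_pinned_le_sum_ae` — levels `s + 1 ≤ k ≤ K`, restricted (41)_k sum, factor `e^{E}`.
* §3 ★★★ `AlphaInputsT3AC.PkgAt.resDensity_pinned_le_lf_sub_ae` — the unit lattice, normal form, penalised `LF`.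

HONEST SCOPE.  Bookkeeping over BRICKS A∕B and the lane's bridge; CONDITIONAL on the package exactly as `AlphaInputsT3ACData.dataT3_ineq41AE` is; the
Thm-1-side row (S-ii) («`hlf` with one factor kept»), S-step, `hP`, `HistoryTailL` (19936) NOT proved; nothing continuum ∕ OS ∕ mass-gap ∕ Clay.
References: T. Bałaban, CMP **102** (1985) 255–275 [Balaban1985UV3] ((2) p. 256, (6)–(8) pp. 257–258, (41) p. 266, (48)–(49) pp. 267–268, Thm 2 p. 272).
-/

set_option autoImplicit false

noncomputable section

namespace Summit.QuantumFields.YangMills.Theorems.UV3PinnedStepOfPackage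

open MeasureTheory
open Literature.MathematicalPhysics.QuantumFieldTheory.Balaban1983to89
open Literature.MathematicalPhysics.QuantumFieldTheory.Balaban1983to89.AveragingRT (rnTransport)
open Literature.MathematicalPhysics.QuantumFieldTheory.Balaban1983to89.T3ContinuumYM3Torus
open Literature.MathematicalPhysics.QuantumFieldTheory.Balaban1983to89.T3UnitLawDensityEML (ℰp measurableE_ℰp emlDensity)
open Literature.MathematicalPhysics.QuantumFieldTheory.Balaban1983to89.T3RestrictedUnitDensity (towerDensity towerDensity_succ resDensity
  resDensity_nonneg integrable_resDensity integral_resDensity_mul emlDensity_eq_towerDensity)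
open Literature.MathematicalPhysics.QuantumFieldTheory.Balaban1983to89.Missing (boltzmann)
open Literature.MathematicalPhysics.QuantumFieldTheory.Balaban1985CMP102
open Literature.MathematicalPhysics.QuantumFieldTheory.Balaban1985CMP102.Setting
open Summit.QuantumFields.Balaban3D.Carriers
open Summit.QuantumFields.Balaban3D.Proofs.Primitives
open Summit.QuantumFields.Balaban3D.Proofs.TowerAC
open Summit.QuantumFields.Balaban3D.Proofs.StandardAC
open Summit.QuantumFields.Balaban3D.Proofs.Inputs
open Summit.QuantumFields.Balaban3D.Proofs.InputsAC
open Summit.QuantumFields.Balaban3D.Proofs.AlphaAC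
open Summit.QuantumFields.Balaban3D.Proofs.Thm2AC
open Summit.QuantumFields.Balaban3D.Proofs.Bound55AC (hint_stdAC)
open Summit.QuantumFields.Balaban3D.Proofs.Bound55Masses (measurable_dev)
open Summit.QuantumFields.YangMills.Theorems.UV3PinnedRestrictedStep (pinned41_above_of_residualsAC)
open Summit.QuantumFields.YangMills.Theorems.UV3PinnedTransportStep (sum_filter_mul_exp_le_lfAC_sub)

/-! ## §1 The cell's tower is the lane's RN iteration; the pin read at level `s` -/

section Cell

variable (F : T3Family) (K : ℕ)

/-- The cell's tower step IS the lane's Radon–Nikodym transport over the pinned averaging `avT3` (lit `towerDensity_succ` + `avT3_of_le`; both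
iterate `rnTransport (blockAvg ℰp)`). [cite: Balaban1985UV3, (2) p.256] -/
theorem towerDensity_succ_eq_rnTransport (ρ₀ : Density (F.P K) 0 (Matrix.specialUnitaryGroup (Fin 2) ℂ)) {k : ℕ} (hk : k + 1 ≤ F.m + K) :
    towerDensity F K ρ₀ (k + 1) = rnTransport (avT3 F K k).avg (towerDensity F K ρ₀ k) := by
  rw [towerDensity_succ F K ρ₀ hk, avT3_of_le F K hk]
  rfl

/-- ★ **THE PIN READ AT ITS OWN LEVEL**: for a measurable set `A` of level-`s` fields, the restricted density of the pulled-back event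
`{U | Ū^s U ∈ A}` at level `s` IS `𝟙_A·ρ_s` `dV_s`-a.e. — both have the same integral against every indicator test function by (2)∕(6)
(lit `integral_resDensity_mul` for the event and for `univ`), hence agree a.e. (`Integrable.ae_eq_of_forall_setIntegral_eq`).  A.e. letters only
(★★OWNER RULING №32). [cite: Balaban1985UV3, (2) p.256 + (6)-(7) p.257] -/
theorem resDensity_preimage_ae_eq_indicator_mul {γ : ℝ} (hγ : 0 ≤ γ) (s : ℕ) (hs : s ≤ F.m + K)
    (A : Set (GaugeField (F.P K) s (Matrix.specialUnitaryGroup (Fin 2) ℂ))) (hA : MeasurableSet A) :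
    resDensity F γ K {U : GaugeField (F.P K) 0 (Matrix.specialUnitaryGroup (Fin 2) ℂ) |
        Averaging.iter (fun i' => BlockAveraging.blockAvg (P := F.P K) (j := i') ℰp) s U ∈ A} s
      =ᵐ[fieldMeasure (F.P K) s (Matrix.specialUnitaryGroup (Fin 2) ℂ)]
      fun V => A.indicator (fun _ => (1 : ℝ)) V * emlDensity F γ K s V := by
  have hiter : Measurable (Averaging.iter (fun i' => BlockAveraging.blockAvg (P := F.P K) (j := i') ℰp) s) :=
    T4Continuum.measurable_iter _ (F.avgMeasurable_of_measurableE ℰp measurableE_ℰp K) s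
  set E : Set (GaugeField (F.P K) 0 (Matrix.specialUnitaryGroup (Fin 2) ℂ)) :=
    {U | Averaging.iter (fun i' => BlockAveraging.blockAvg (P := F.P K) (j := i') ℰp) s U ∈ A} with hE
  have hEm : MeasurableSet E := hiter hA
  haveI := Missing.isProbabilityMeasure_fieldMeasure (G := Matrix.specialUnitaryGroup (Fin 2) ℂ) (F.P K) s
  have hρE := integrable_resDensity F K (S := E) hEm hγ hs
  have hρU := integrable_resDensity F K (S := Set.univ) MeasurableSet.univ hγ hs
  have huniv : resDensity F γ K Set.univ s = emlDensity F γ K s := by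
    unfold resDensity
    rw [Set.indicator_univ, ← emlDensity_eq_towerDensity]
  have hind01 : ∀ V, 0 ≤ A.indicator (fun _ => (1 : ℝ)) V ∧ A.indicator (fun _ => (1 : ℝ)) V ≤ 1 := fun V => by
    by_cases hV : V ∈ A
    · rw [Set.indicator_of_mem hV]; exact ⟨zero_le_one, le_rfl⟩
    · rw [Set.indicator_of_notMem hV]; exact ⟨le_rfl, zero_le_one⟩
  have hrhs : Integrable (fun V => A.indicator (fun _ => (1 : ℝ)) V * emlDensity F γ K s V)
      (fieldMeasure (F.P K) s (Matrix.specialUnitaryGroup (Fin 2) ℂ)) := by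
    rw [← huniv]
    refine hρU.bdd_mul (measurable_one.indicator hA).aestronglyMeasurable (c := 1) (Filter.Eventually.of_forall fun V => ?_)
    rw [Real.norm_eq_abs, abs_of_nonneg (hind01 V).1]
    exact (hind01 V).2
  refine Integrable.ae_eq_of_forall_setIntegral_eq _ _ hρE hrhs fun t ht _ => ?_
  have hbd : ∃ B : ℝ, ∀ V : GaugeField (F.P K) s (Matrix.specialUnitaryGroup (Fin 2) ℂ),
      |t.indicator (1 : GaugeField (F.P K) s (Matrix.specialUnitaryGroup (Fin 2) ℂ) → ℝ) V| ≤ B := by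
    refine ⟨1, fun V => ?_⟩
    by_cases hV : V ∈ t
    · rw [Set.indicator_of_mem hV]; simp
    · rw [Set.indicator_of_notMem hV]; simp
  have hbd' : ∃ B : ℝ, ∀ V : GaugeField (F.P K) s (Matrix.specialUnitaryGroup (Fin 2) ℂ),
      |A.indicator (fun _ => (1 : ℝ)) V * t.indicator (1 : GaugeField (F.P K) s (Matrix.specialUnitaryGroup (Fin 2) ℂ) → ℝ) V| ≤ B := by
    refine ⟨1, fun V => ?_⟩
    rw [abs_mul]
    by_cases hV : V ∈ t
    · rw [Set.indicator_of_mem hV]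
      simp only [Pi.one_apply, abs_one, mul_one]
      rw [abs_of_nonneg (hind01 V).1]; exact (hind01 V).2
    · rw [Set.indicator_of_notMem hV]; simp
  have h1 := integral_resDensity_mul F K (S := E) hEm hγ hs (t.indicator 1) (measurable_one.indicator ht) hbd
  have h2 := integral_resDensity_mul F K (S := Set.univ) MeasurableSet.univ hγ hs
    (fun V => A.indicator (fun _ => (1 : ℝ)) V * t.indicator 1 V)
    ((measurable_one.indicator hA).mul (measurable_one.indicator ht)) hbd'
  rw [← integral_indicator ht, ← integral_indicator ht]
  have e1 : ∫ V, t.indicator (resDensity F γ K E s) V ∂fieldMeasure (F.P K) s (Matrix.specialUnitaryGroup (Fin 2) ℂ) =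
      ∫ V, resDensity F γ K E s V * t.indicator 1 V ∂fieldMeasure (F.P K) s (Matrix.specialUnitaryGroup (Fin 2) ℂ) := by
    refine integral_congr_ae (Filter.Eventually.of_forall fun V => ?_)
    by_cases hV : V ∈ t <;> simp [hV]
  have e2 : ∫ V, t.indicator (fun V => A.indicator (fun _ => (1 : ℝ)) V * emlDensity F γ K s V) V
        ∂fieldMeasure (F.P K) s (Matrix.specialUnitaryGroup (Fin 2) ℂ) =
      ∫ V, resDensity F γ K Set.univ s V * (A.indicator (fun _ => (1 : ℝ)) V * t.indicator 1 V)
        ∂fieldMeasure (F.P K) s (Matrix.specialUnitaryGroup (Fin 2) ℂ) := by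
    rw [huniv]
    refine integral_congr_ae (Filter.Eventually.of_forall fun V => ?_)
    by_cases hV : V ∈ t <;> simp [hV, mul_comm]
  rw [e1, e2, h1, h2]
  refine integral_congr_ae (Filter.Eventually.of_forall fun U => ?_)
  show E.indicator (boltzmann (F.P K) ((F.scheme ℰp γ).β K)) U * t.indicator 1 (Averaging.iter _ s U) =
    Set.univ.indicator (boltzmann (F.P K) ((F.scheme ℰp γ).β K)) U *
      (A.indicator (fun _ => (1 : ℝ)) (Averaging.iter _ s U) * t.indicator 1 (Averaging.iter _ s U))
  rw [Set.indicator_univ]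
  by_cases hU : U ∈ E
  · have hUA : Averaging.iter (fun i' => BlockAveraging.blockAvg (P := F.P K) (j := i') ℰp) s U ∈ A := hU
    rw [Set.indicator_of_mem hU, Set.indicator_of_mem hUA]; ring
  · have hUA : Averaging.iter (fun i' => BlockAveraging.blockAvg (P := F.P K) (j := i') ℰp) s U ∉ A := hU
    rw [Set.indicator_of_notMem hU, Set.indicator_of_notMem hUA]; ring

end Cell

/-! ## §2 Row (S-i): the pinned (41) for `resDensity` above the pin, under the package -/

section Package

variable {F : T3Family} {𝔠 : AlphaConsts F.L (suGroupModel 2).N} {γ : ℝ} {hγ : 0 < γ} {hγ1 : γ ≤ (min 𝔠.gamma0 1) ^ 2} {K : ℕ}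
  (p : AlphaInputsT3AC.PkgAt F 𝔠 γ hγ hγ1 K)

open Classical in
/-- ★★★ **ROW (S-i) — THE PINNED (41) FOR THE ROUTE'S RESTRICTED DENSITY ABOVE THE PIN, MODULO THE PACKAGE.**  Under the package's data `p` at
`(γ, K)`: for a pinned level `s` with `s + 1 ≤ K`, a level-`s` plaquette `a` and a threshold `θ ≥ eps1Of s` (the lane's large-field threshold at the
package profile), at every level `s + 1 ≤ k ≤ K` and `dV_k`-a.e.,
`resDensity F γ K {U | θ ≤ dist1 (Ū^s U)(∂a)} k ≤ e^{E} · Σ_{h : a ∈ h(s) ∨ ¬ plaqCover a ⊆ Ω_s(h↾s)} m_k(h)·exp[−mainT_k + Pint_k − E_k + Zterm_k + Rm_k]`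
with the lane tower's masses and exponents (`towerOfAC 𝔠.lane p.X p.𝔖`).  Proof: B2 §5 on `σ_k := e^{−E}·resDensity(pin) k` — recursion a.e. by
`towerDensity_succ_eq_rnTransport` + `rnTransport_const_mul_ae`; pin level by §1 + `PkgAt.resDensity_ae_eq`; residual leaves ∕ `hint` ∕ `fibre49`
from `p.run`. [cite: Balaban1985UV3, (2) p.256 + (7)-(8) pp.257-258 + (41) p.266 + (48)-(49) pp.267-268 + Thm 2 p.272] -/
theorem _root_.Summit.QuantumFields.YangMills.Theorems.AlphaInputsT3AC.PkgAt.resDensity_pinned_le_sum_ae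
    (s : ℕ) (hs : s + 1 ≤ K) (a : Plaq (F.P K) s) (θ : ℝ)
    (hθ : eps1Of (T3Scales F γ hγ (hγ1.trans (sq_min_one_le _ 𝔠.gamma0_pos)) K) 𝔠.lane.carrier s ≤ θ) :
    ∀ (k : ℕ) (hsk : s + 1 ≤ k), k ≤ K → ∀ᵐ W ∂fieldMeasure (F.P K) k (Matrix.specialUnitaryGroup (Fin 2) ℂ),
      resDensity F γ K {U : GaugeField (F.P K) 0 (Matrix.specialUnitaryGroup (Fin 2) ℂ) |
          θ ≤ dist1 (GaugeField.plaqHol (Averaging.iter (fun i' => BlockAveraging.blockAvg (P := F.P K) (j := i') ℰp) s U) a)} k W ≤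
        Real.exp p.E *
          ∑ h ∈ Finset.univ.filter (fun h : Hist (F.P K) k =>
              a ∈ h ⟨s, hsk⟩ ∨ ¬ plaqCover a ⊆ Omega 𝔠.lane.carrier.M₁
                (rcolOf (T3Scales F γ hγ (hγ1.trans (sq_min_one_le _ 𝔠.gamma0_pos)) K) 𝔠.lane.carrier) s
                (fun j : Fin s => h (Fin.castLE (Nat.le_of_succ_le hsk) j)) s),
            (inputOfAC 𝔠.lane p.X p.𝔖).W.mass k h W *
              Real.exp (-(p.T.mainT k h W) + p.T.Pint k h W - p.T.Ecst k + p.T.Zterm k h + p.T.Rm k) := by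
  intro k hsk hkK
  have hγ0 : 0 ≤ γ := hγ.le
  -- the pinned event and its level-`s` reading
  set A : Set (GaugeField (F.P K) s (Matrix.specialUnitaryGroup (Fin 2) ℂ)) := {V | θ ≤ dist1 (GaugeField.plaqHol V a)} with hAdef
  have hA : MeasurableSet A := measurableSet_le measurable_const (measurable_dev a)
  set E : Set (GaugeField (F.P K) 0 (Matrix.specialUnitaryGroup (Fin 2) ℂ)) :=
    {U | θ ≤ dist1 (GaugeField.plaqHol (Averaging.iter (fun i' => BlockAveraging.blockAvg (P := F.P K) (j := i') ℰp) s U) a)} with hEdef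
  have hEA : E = {U | Averaging.iter (fun i' => BlockAveraging.blockAvg (P := F.P K) (j := i') ℰp) s U ∈ A} := rfl
  have hiter : Measurable (Averaging.iter (fun i' => BlockAveraging.blockAvg (P := F.P K) (j := i') ℰp) s) :=
    T4Continuum.measurable_iter _ (F.avgMeasurable_of_measurableE ℰp measurableE_ℰp K) s
  have hEm : MeasurableSet E := by rw [hEA]; exact hiter hA
  -- the rescaled pinned tower `σ_k := e^{−E}·ρ^E_k`
  set σ : (k : ℕ) → Density (F.P K) k (Matrix.specialUnitaryGroup (Fin 2) ℂ) := fun k V => Real.exp (-p.E) * resDensity F γ K E k V with hσ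
  have hσ0 : ∀ k U, 0 ≤ σ k U := fun k U => mul_nonneg (Real.exp_nonneg _) (resDensity_nonneg F γ K E k U)
  have hσi : ∀ k, Integrable (σ k) (fieldMeasure (F.P K) k (Matrix.specialUnitaryGroup (Fin 2) ℂ)) := by
    intro k
    by_cases hk : k ≤ F.m + K
    · exact (integrable_resDensity F K (S := E) hEm hγ0 hk).const_mul _
    · -- beyond the standing range the tower is `0`
      have hz : resDensity F γ K E k = fun _ => 0 := by
        obtain ⟨k', rfl⟩ : ∃ k', k = k' + 1 := ⟨k - 1, by omega⟩
        unfold resDensity towerDensity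
        rw [dif_neg hk]
      have : σ k = fun _ => 0 := by funext V; simp only [hσ, hz, mul_zero]
      rw [this]; exact integrable_const 0
  have hσT : ∀ k, s ≤ k → k + 1 ≤ (T3Scales F γ hγ (hγ1.trans (sq_min_one_le _ 𝔠.gamma0_pos)) K).K →
      σ (k + 1) =ᵐ[fieldMeasure (F.P K) (k + 1) (Matrix.specialUnitaryGroup (Fin 2) ℂ)] rnTransport (p.X.av k).avg (σ k) := by
    intro k _ hk1
    have hk1' : k + 1 ≤ K := hk1
    have hkm : k + 1 ≤ F.m + K := by omega
    have hstep : resDensity F γ K E (k + 1) = rnTransport (avT3 F K k).avg (resDensity F γ K E k) :=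
      towerDensity_succ_eq_rnTransport F K _ hkm
    have hav : p.X.av k = avT3 F K k := rfl
    have hc := rnTransport_const_mul_ae (avT3 F K k).avg (resDensity F γ K E k) (resDensity_nonneg F γ K E k)
      (integrable_resDensity F K (S := E) hEm hγ0 (by omega)) (Real.exp_nonneg (-p.E))
    rw [hav]
    filter_upwards [hc] with V hV
    show Real.exp (-p.E) * resDensity F γ K E (k + 1) V = rnTransport (avT3 F K k).avg (fun U => Real.exp (-p.E) * resDensity F γ K E k U) V
    rw [hV, hstep]
  have hσs : σ s ≤ᵐ[fieldMeasure (F.P K) s (Matrix.specialUnitaryGroup (Fin 2) ℂ)] fun U =>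
      A.indicator (fun _ => (1 : ℝ)) U * p.T.ρ s U := by
    have h1 := resDensity_preimage_ae_eq_indicator_mul F K hγ0 s (by omega) A hA
    have h2 := p.resDensity_ae_eq s (by omega)
    have huniv : resDensity F γ K Set.univ s = emlDensity F γ K s := by
      unfold resDensity
      rw [Set.indicator_univ, ← emlDensity_eq_towerDensity]
    rw [huniv] at h2
    rw [← hEA] at h1
    filter_upwards [h1, h2] with V hV1 hV2
    show Real.exp (-p.E) * resDensity F γ K E s V ≤ A.indicator (fun _ => (1 : ℝ)) V * p.T.ρ s V
    rw [hV1, hV2]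
    have : Real.exp (-p.E) * (A.indicator (fun _ => (1 : ℝ)) V * (Real.exp p.E * p.T.ρ s V)) =
        A.indicator (fun _ => (1 : ℝ)) V * p.T.ρ s V := by
      have hee : Real.exp (-p.E) * Real.exp p.E = 1 := by rw [← Real.exp_add, neg_add_cancel, Real.exp_zero]
      calc Real.exp (-p.E) * (A.indicator (fun _ => (1 : ℝ)) V * (Real.exp p.E * p.T.ρ s V))
          = (Real.exp (-p.E) * Real.exp p.E) * (A.indicator (fun _ => (1 : ℝ)) V * p.T.ρ s V) := by ring
        _ = _ := by rw [hee, one_mul]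
    rw [this]
  -- the (α) rows of the package
  have hw : (T3Scales F γ hγ (hγ1.trans (sq_min_one_le _ 𝔠.gamma0_pos)) K).g ^ 2 *
      (T3Scales F γ hγ (hγ1.trans (sq_min_one_le _ 𝔠.gamma0_pos)) K).ε₀ ≤ 1 :=
    (T3Scales F γ hγ (hγ1.trans (sq_min_one_le _ 𝔠.gamma0_pos)) K).gK_le_one
  have hwin := T3Scales_window F 𝔠 γ hγ hγ1 K
  have R : ∀ j, j + 1 ≤ (T3Scales F γ hγ (hγ1.trans (sq_min_one_le _ 𝔠.gamma0_pos)) K).K →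
      StepResidualsAC 𝔠.lane p.X p.𝔖 j := fun j hj => stepResidualsAC_of_alpha hwin j hj (p.run.steps j hj)
  have hint : ∀ j, j + 1 ≤ (T3Scales F γ hγ (hγ1.trans (sq_min_one_le _ 𝔠.gamma0_pos)) K).K → ∀ h : Hist (F.P K) j,
      Integrable (fun U => (inputOfAC 𝔠.lane p.X p.𝔖).W.mass j h U *
        Real.exp (-((towerWAC 𝔠.lane p.X p.𝔖).mainT j h U) + (inputOfAC 𝔠.lane p.X p.𝔖).Pint j h U - (towerWAC 𝔠.lane p.X p.𝔖).Ecst j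
          + (towerWAC 𝔠.lane p.X p.𝔖).Zterm j h + (towerWAC 𝔠.lane p.X p.𝔖).Rm j)) (fieldMeasure (F.P K) j (Matrix.specialUnitaryGroup (Fin 2) ℂ)) :=
    fun j hj => hint_stdAC p.X 𝔠.lane.carrier p.𝔖 (fun _ => True) j (p.run.steps j hj).hU (p.run.steps j hj).hPm (p.𝔄.cP j)
      (p.run.steps j hj).hPb
  have hmain := pinned41_above_of_residualsAC 𝔠.lane p.𝔖 hw R hint (fun j hj h' => (p.run.steps j hj).fibre49 h') s hs a θ hθ σ hσ0 hσi
    hσT hσs k hsk hkK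
  have hpos : 0 < Real.exp p.E := Real.exp_pos _
  filter_upwards [hmain] with W hW
  have hW' := mul_le_mul_of_nonneg_left hW hpos.le
  have hlhs : Real.exp p.E * σ k W = resDensity F γ K E k W := by
    show Real.exp p.E * (Real.exp (-p.E) * resDensity F γ K E k W) = _
    rw [← mul_assoc, ← Real.exp_add, add_neg_cancel, Real.exp_zero, one_mul]
  rw [hlhs] at hW'
  exact hW'

/-! ## §3 The unit lattice: normal form against the penalised functional -/

open Classical in
/-- ★★★ **ROW (S-i) AT THE UNIT LATTICE, NORMAL FORM, PENALISED FUNCTIONAL.**  Under the package's data `p` at `(γ, K)`, for the pin as in §2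
(`s + 1 ≤ K`, `θ ≥ eps1Of s`) and ANY penalty `π : Hist K → ℝ` VANISHING on the pinned family (arbitrary — e.g. `≥ M` — off it): `dV_K`-a.e.,
`resDensity F γ K {U | θ ≤ dist1 (Ū^s U)(∂a)} K ≤ exp(−(E_K − E) + Rm_K) · LF_K(W)[h ↦ −mainT_K(h,W) + Pint_K(h,W) + Zterm_K(h) − π h]`
— the interface's (41)′_K (`Ineq41AE` shape, `Ecst K K = E_K − E`) with the history functional PENALISED OFF THE PIN: the `hUP`-side input of
✓`UV3PinnedLargeFieldResummation.largeField_pinned_of_resummation` ∕ the anchored S-step row, modulo the Thm-1-side pinned leaf (S-ii) only.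
[cite: Balaban1985UV3, (41) p.266 + (48)-(49) pp.267-268 + Thm 2 p.272] -/
theorem _root_.Summit.QuantumFields.YangMills.Theorems.AlphaInputsT3AC.PkgAt.resDensity_pinned_le_lf_sub_ae
    (s : ℕ) (hs : s + 1 ≤ K) (a : Plaq (F.P K) s) (θ : ℝ)
    (hθ : eps1Of (T3Scales F γ hγ (hγ1.trans (sq_min_one_le _ 𝔠.gamma0_pos)) K) 𝔠.lane.carrier s ≤ θ)
    (π : Hist (F.P K) K → ℝ)
    (hπ : ∀ h : Hist (F.P K) K, (a ∈ h ⟨s, hs⟩ ∨ ¬ plaqCover a ⊆ Omega 𝔠.lane.carrier.M₁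
        (rcolOf (T3Scales F γ hγ (hγ1.trans (sq_min_one_le _ 𝔠.gamma0_pos)) K) 𝔠.lane.carrier) s
        (fun j : Fin s => h (Fin.castLE (Nat.le_of_succ_le hs) j)) s) → π h = 0) :
    ∀ᵐ W ∂fieldMeasure (F.P K) K (Matrix.specialUnitaryGroup (Fin 2) ℂ),
      resDensity F γ K {U : GaugeField (F.P K) 0 (Matrix.specialUnitaryGroup (Fin 2) ℂ) |
          θ ≤ dist1 (GaugeField.plaqHol (Averaging.iter (fun i' => BlockAveraging.blockAvg (P := F.P K) (j := i') ℰp) s U) a)} K W ≤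
        Real.exp (-(p.T.Ecst K - p.E) + p.T.Rm K) *
          p.T.LF K W (fun h => -(p.T.mainT K h W) + p.T.Pint K h W + p.T.Zterm K h - π h) := by
  have hmain := p.resDensity_pinned_le_sum_ae s hs a θ hθ K hs le_rfl
  filter_upwards [hmain] with W hW
  refine hW.trans ?_
  -- pull the constants out of the restricted sum
  set Sf := Finset.univ.filter (fun h : Hist (F.P K) K =>
      a ∈ h ⟨s, hs⟩ ∨ ¬ plaqCover a ⊆ Omega 𝔠.lane.carrier.M₁
        (rcolOf (T3Scales F γ hγ (hγ1.trans (sq_min_one_le _ 𝔠.gamma0_pos)) K) 𝔠.lane.carrier) s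
        (fun j : Fin s => h (Fin.castLE (Nat.le_of_succ_le hs) j)) s) with hSf
  have hsplit : ∑ h ∈ Sf, (inputOfAC 𝔠.lane p.X p.𝔖).W.mass K h W *
        Real.exp (-(p.T.mainT K h W) + p.T.Pint K h W - p.T.Ecst K + p.T.Zterm K h + p.T.Rm K)
      = Real.exp (-(p.T.Ecst K) + p.T.Rm K) * ∑ h ∈ Sf, (inputOfAC 𝔠.lane p.X p.𝔖).W.mass K h W *
        Real.exp (-(p.T.mainT K h W) + p.T.Pint K h W + p.T.Zterm K h) := by
    rw [Finset.mul_sum]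
    refine Finset.sum_congr rfl fun h _ => ?_
    have : -(p.T.mainT K h W) + p.T.Pint K h W - p.T.Ecst K + p.T.Zterm K h + p.T.Rm K
        = (-(p.T.mainT K h W) + p.T.Pint K h W + p.T.Zterm K h) + (-(p.T.Ecst K) + p.T.Rm K) := by ring
    rw [this, Real.exp_add]; ring
  rw [hsplit, ← mul_assoc, ← Real.exp_add]
  have hE : p.E + (-(p.T.Ecst K) + p.T.Rm K) = -(p.T.Ecst K - p.E) + p.T.Rm K := by ring
  rw [hE]
  refine mul_le_mul_of_nonneg_left ?_ (Real.exp_nonneg _)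
  -- restricted sum ≤ penalised functional (BRICK A §3); `p.T.LF = LFAC` of the lane's masses
  have hres := sum_filter_mul_exp_le_lfAC_sub (inputOfAC 𝔠.lane p.X p.𝔖).W K W
    (fun h => -(p.T.mainT K h W) + p.T.Pint K h W + p.T.Zterm K h) π Sf
    (fun h hh => hπ h (by rw [hSf] at hh; exact (Finset.mem_filter.mp hh).2))
  exact hres

end Package

end Summit.QuantumFields.YangMills.Theorems.UV3PinnedStepOfPackage

end
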